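import Mathlib
import HarnessLib
import Summits.Ventures.LatticeQCDFlow.Exactness.LatticeBoundedDifferences
import Summits.Ventures.LatticeQCDFlow.Exactness.SphereIndependenceSamplerAcceptance
import Summits.Ventures.LatticeQCDFlow.Exactness.LatticeIndependenceSamplerAcceptanceCeiling
import Summits.Ventures.LatticeQCDFlow.Exactness.LatticeIndependenceSamplerEventTauInt

/-!
# The bounded-differences side of the volume laws for an independence sampler on a lattice of compact sites: per-site differences `D_k` of the log-weight give `KL ≤ ΣD_k²/8`, `∫e^{−2F}/(∫e^{−F})² ≤ e^{ΣD_k²/2}`, `acc ≥ exp(−(ΣD_k²/8 + √(ΣD_k²/8)))` and `τ_int(1_A) ≤ ½ + 12·(p∨(1−p))/(p∧(1−p))·e^{ΣD_k²/2}`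

HONEST FRAMING: exact (Metropolis-corrected) sampling algorithms for lattice gauge theory;
figures of merit are autocorrelation/cost numbers at stated couplings and volumes; no
continuum-physics claim.

Venture `LatticeQCDFlow` (cell pub-lqcd), topic `Exactness`; FANOUT row 7 (`s0-cpn-null`).  NEW WORK
of the cell over this lineage's `Exactness/LatticeBoundedDifferences.lean` (McDiarmid's
exponential-moment bound and the Efron–Stein–Popoviciu variance bound on a finite product of compact
probability spaces), `Exactness/SphereIndependenceSamplerAcceptance.lean` (§1–§2 there: Jensen for
`exp`, the pair functional on a compact metric probability space),
`Exactness/LatticeIndependenceSamplerAcceptanceCeiling.lean` (the closed form of the mean acceptance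
on `X^ι`) and `Exactness/LatticeIndependenceSamplerEventTauInt.lean` (the inverse-ESS ceiling of
`τ_int(1_A)`); nothing is cited as a fact.  Printed counterparts, NAMED ONLY: McDiarmid 1989 Lemma
(1.2); Albergo–Kanwar–Shanahan 2019 §II; Abbott et al. 2022 §V.  THE UPPER SIDE OF THE GENERIC TWO-SIDED
VOLUME LAWS.  Sites `ι` (finite), compact metric site space `X` with a Borel probability measure `μ`,
`π = ⊗_ι μ`, a continuous log-weight `F` on `Ω = X^ι` with BOUNDED DIFFERENCES
`F(ω[k←v]) − F(ω[k←v']) ≤ D_k`; the independence Metropolis sampler with target `π.tilted(−F)` and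
proposal `π` (row 2's `imhOp π e^{−F} 1`).  Then: the reverse relative entropy `∫F dπ + log∫e^{−F}dπ` is
at most `ΣD_k²/8`; the inverse effective-sample-size fraction `∫e^{−2F}dπ/(∫e^{−F}dπ)²` is at most
`e^{ΣD_k²/2}`; the mean acceptance is at least `exp(−(ΣD_k²/8 + √(ΣD_k²/8)))`; and for every event `A`
of target probability `p ∈ (0,1)`, `τ_int(1_A) ≤ ½ + 12·(p∨(1−p))/(p∧(1−p))·e^{ΣD_k²/2}`.  With the
block-defect floors of `LatticeIndependenceSamplerEntropyFloor`, `LatticeBlockSecondMomentTensorization`,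
`LatticeIndependenceSamplerAcceptanceCeiling` and `LatticeIndependenceSamplerEventTauInt` this is the
generic two-sided statement: per-site differences `O(ε)` keep every figure of merit within
`e^{O(|ι|ε²)}`, while `#T` non-degenerate blocks of defect `θ` push them beyond `e^{#T·θ}` — for
fixed-receptive-field exact samplers on continuous compact configuration spaces.  (The lattice-of-spheres
/ exact-flow instances are `SphereFlowSamplerVolumeLaw`, `SphereFlowSamplerAcceptanceLaw`,
`SphereLOFlow*`.)

## Content (`m = ∫F dπ`, `Σ = Σ_k D_k²`)

* **`latticeIndep_integral_add_log_le_of_bddDiff`** — `∫F dπ + log∫e^{−F}dπ ≤ Σ/8`.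
* **`latticeIndep_integral_exp_neg_two_mul_le_of_bddDiff`** — `∫e^{−2F}dπ ≤ e^{Σ/2}·(∫e^{−F}dπ)²`.
* `latticeIndep_exp_neg_le_meanAccept_of_mgf_of_variance` — `acc ≥ exp(−(a + √(v/2)))` from an
  exponential-moment bound `a` and a variance bound `v` (generic form of the lattice-of-spheres lemma);
  **`latticeIndep_exp_neg_le_meanAccept_of_bddDiff`** — `acc ≥ exp(−(Σ/8 + √(Σ/8)))`.
* **`latticeIndep_event_tauInt_le_of_bddDiff`** — `τ_int(1_A) ≤ ½ + 12·(p∨(1−p))/(p∧(1−p))·e^{Σ/2}`.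

NOT CLAIMED: how to obtain the `D_k` for a given sampler (model-specific); non-compact sites; numbers.
-/

noncomputable section

namespace Summit.Ventures.LatticeQCDFlow.Exactness

open Function Set Metric MeasureTheory
open Summit.Ventures.LatticeQCDFlow.Scoring
open scoped Topology

variable {ι : Type*} [Fintype ι] [DecidableEq ι]
variable {X : Type*} [MeasurableSpace X] [MetricSpace X] [CompactSpace X] [BorelSpace X]
  (μ : Measure X) [IsProbabilityMeasure μ]

/-! ## §1 Relative entropy and second moment -/

/-- **`KL(π ‖ π.tilted(−F)) = ∫F dπ + log∫e^{−F}dπ ≤ ΣD_k²/8`** for a continuous log-weight with bounded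
differences (McDiarmid at `t = −1`). -/
theorem latticeIndep_integral_add_log_le_of_bddDiff {F : (ι → X) → ℝ} (hF : Continuous F) {D : ι → ℝ}
    (hD : ∀ ω k v v', F (update ω k v) - F (update ω k v') ≤ D k) :
    (∫ ω, F ω ∂Measure.pi (fun _ : ι => μ)) +
        Real.log (∫ ω, Real.exp (-F ω) ∂Measure.pi (fun _ : ι => μ)) ≤ (∑ k, D k ^ 2) / 8 := by
  set π : Measure (ι → X) := Measure.pi (fun _ : ι => μ) with hπ
  set m : ℝ := ∫ ω, F ω ∂π with hm
  have hmgf := mcdiarmid_integral_exp_le μ hF hD (-1)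
  rw [← hπ, ← hm] at hmgf
  have e : ∫ ω, Real.exp (-F ω) ∂π = Real.exp (-m) * ∫ ω, Real.exp (-1 * (F ω - m)) ∂π := by
    rw [← integral_const_mul]
    refine integral_congr_ae (ae_of_all _ fun ω => ?_)
    show Real.exp (-F ω) = Real.exp (-m) * Real.exp (-1 * (F ω - m))
    rw [← Real.exp_add]; congr 1; ring
  have hpos : 0 < ∫ ω, Real.exp (-1 * (F ω - m)) ∂π :=
    integral_exp_pos (integrable_pi_of_continuous μ (continuous_const.mul (hF.sub continuous_const)).rexp)
  rw [e, Real.log_mul (Real.exp_pos _).ne' hpos.ne', Real.log_exp]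
  have hlog : Real.log (∫ ω, Real.exp (-1 * (F ω - m)) ∂π) ≤ (-1) ^ 2 * (∑ k, D k ^ 2) / 8 := by
    rw [← Real.log_exp ((-1) ^ 2 * (∑ k, D k ^ 2) / 8)]
    exact Real.log_le_log hpos hmgf
  have : (-1 : ℝ) ^ 2 * (∑ k, D k ^ 2) / 8 = (∑ k, D k ^ 2) / 8 := by ring
  linarith

/-- **`∫e^{−2F}dπ ≤ e^{ΣD_k²/2}·(∫e^{−F}dπ)²`**: the inverse effective-sample-size fraction of the weights
`e^{−F}` is at most `e^{ΣD_k²/2}` (McDiarmid at `t = −2` and Jensen `e^{−∫F} ≤ ∫e^{−F}`). -/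
theorem latticeIndep_integral_exp_neg_two_mul_le_of_bddDiff {F : (ι → X) → ℝ} (hF : Continuous F)
    {D : ι → ℝ} (hD : ∀ ω k v v', F (update ω k v) - F (update ω k v') ≤ D k) :
    ∫ ω, Real.exp (-2 * F ω) ∂Measure.pi (fun _ : ι => μ) ≤
      Real.exp ((∑ k, D k ^ 2) / 2) * (∫ ω, Real.exp (-F ω) ∂Measure.pi (fun _ : ι => μ)) ^ 2 := by
  set π : Measure (ι → X) := Measure.pi (fun _ : ι => μ) with hπ
  set m : ℝ := ∫ ω, F ω ∂π with hm
  have hmgf := mcdiarmid_integral_exp_le μ hF hD (-2)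
  rw [← hπ, ← hm] at hmgf
  have e : ∫ ω, Real.exp (-2 * F ω) ∂π = Real.exp (-2 * m) * ∫ ω, Real.exp (-2 * (F ω - m)) ∂π := by
    rw [← integral_const_mul]
    refine integral_congr_ae (ae_of_all _ fun ω => ?_)
    show Real.exp (-2 * F ω) = Real.exp (-2 * m) * Real.exp (-2 * (F ω - m))
    rw [← Real.exp_add]; congr 1; ring
  -- Jensen: `e^{−m} ≤ ∫ e^{−F}`
  have hFn : Integrable (fun ω => -F ω) π := (integrable_pi_of_continuous μ hF).neg
  have hJ := exp_integral_le_integral_exp (ν := π) hFn (integrable_pi_of_continuous μ hF.neg.rexp)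
  rw [integral_neg] at hJ
  have hJ2 : Real.exp (-2 * m) ≤ (∫ ω, Real.exp (-F ω) ∂π) ^ 2 := by
    have e2 : Real.exp (-2 * m) = Real.exp (-m) ^ 2 := by
      rw [← Real.exp_nat_mul]; congr 1; push_cast; ring
    rw [e2]
    exact pow_le_pow_left₀ (Real.exp_pos _).le hJ 2
  have h4 : (-2 : ℝ) ^ 2 * (∑ k, D k ^ 2) / 8 = (∑ k, D k ^ 2) / 2 := by ring
  rw [h4] at hmgf
  rw [e]
  calc Real.exp (-2 * m) * ∫ ω, Real.exp (-2 * (F ω - m)) ∂π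
      ≤ (∫ ω, Real.exp (-F ω) ∂π) ^ 2 * Real.exp ((∑ k, D k ^ 2) / 2) :=
        mul_le_mul hJ2 hmgf (integral_nonneg fun ω => (Real.exp_pos _).le) (sq_nonneg _)
    _ = Real.exp ((∑ k, D k ^ 2) / 2) * (∫ ω, Real.exp (-F ω) ∂π) ^ 2 := mul_comm _ _

/-! ## §2 The acceptance floor -/

omit [DecidableEq ι] in
/-- **ACCEPTANCE FROM CONCENTRATION OF THE LOG-WEIGHTS (compact sites)**: for continuous `F` on `X^ι`
with `∫ e^{−(F − ∫F)} dπ ≤ e^{a}` and `∫ (F − ∫F)² dπ ≤ v`, the mean acceptance of the independence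
sampler (target `π.tilted(−F)`, proposal `π`) is at least `exp(−(a + √(v/2)))`. -/
theorem latticeIndep_exp_neg_le_meanAccept_of_mgf_of_variance {F : (ι → X) → ℝ} (hF : Continuous F)
    {a v : ℝ}
    (hmgf : ∫ ω, Real.exp (-(F ω - ∫ ω', F ω' ∂Measure.pi (fun _ : ι => μ)))
        ∂Measure.pi (fun _ : ι => μ) ≤ Real.exp a)
    (hvar : ∫ ω, (F ω - ∫ ω', F ω' ∂Measure.pi (fun _ : ι => μ)) ^ 2
        ∂Measure.pi (fun _ : ι => μ) ≤ v) :
    Real.exp (-(a + Real.sqrt (v / 2))) ≤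
      ∫ ω, (∫ ω', min 1 (Real.exp (F ω - F ω')) ∂Measure.pi (fun _ : ι => μ))
        ∂(Measure.pi (fun _ : ι => μ)).tilted (fun ω => -F ω) := by
  set π : Measure (ι → X) := Measure.pi (fun _ : ι => μ) with hπ
  rw [latticeIndep_meanAccept_eq μ F]
  set m : ℝ := ∫ ω', F ω' ∂π with hm
  set I : ℝ := ∫ ω, ∫ ω', |F ω - F ω'| ∂π ∂π with hI
  have hZ : ∫ ω, Real.exp (-F ω) ∂π ≤ Real.exp (-m) * Real.exp a := by
    have e : ∀ ω, Real.exp (-F ω) = Real.exp (-m) * Real.exp (-(F ω - m)) := by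
      intro ω; rw [← Real.exp_add]; congr 1; ring
    simp_rw [e]
    rw [integral_const_mul]
    exact mul_le_mul_of_nonneg_left hmgf (Real.exp_pos _).le
  have hZpos : 0 < ∫ ω, Real.exp (-F ω) ∂π :=
    integral_exp_pos (integrable_pi_of_continuous μ (Real.continuous_exp.comp hF.neg))
  have hN := exp_neg_le_integral_integral_exp_neg_max π hF
  have hIle : I ≤ Real.sqrt (2 * v) := by
    refine (integral_integral_abs_sub_le π hF).trans (Real.sqrt_le_sqrt ?_)
    linarith
  have hsq : (1 / 2) * I ≤ Real.sqrt (v / 2) := by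
    have h2 : Real.sqrt (2 * v) = 2 * Real.sqrt (v / 2) := by
      rw [show (2 : ℝ) * v = 2 ^ 2 * (v / 2) by ring, Real.sqrt_mul (by norm_num), Real.sqrt_sq (by norm_num)]
    rw [h2] at hIle
    linarith
  rw [le_div_iff₀ hZpos]
  calc Real.exp (-(a + Real.sqrt (v / 2))) * ∫ ω, Real.exp (-F ω) ∂π
      ≤ Real.exp (-(a + Real.sqrt (v / 2))) * (Real.exp (-m) * Real.exp a) :=
        mul_le_mul_of_nonneg_left hZ (Real.exp_pos _).le
    _ = Real.exp (-(m + Real.sqrt (v / 2))) := by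
        rw [← Real.exp_add, ← Real.exp_add]; congr 1; ring
    _ ≤ Real.exp (-(m + (1 / 2) * I)) := Real.exp_le_exp.2 (by linarith)
    _ ≤ _ := hN

/-- **THE ACCEPTANCE FLOOR FROM BOUNDED DIFFERENCES (compact sites)**: `acc ≥ exp(−(ΣD_k²/8 + √(ΣD_k²/8)))`. -/
theorem latticeIndep_exp_neg_le_meanAccept_of_bddDiff {F : (ι → X) → ℝ} (hF : Continuous F)
    {D : ι → ℝ} (hD : ∀ ω k v v', F (update ω k v) - F (update ω k v') ≤ D k) :
    Real.exp (-((∑ k, D k ^ 2) / 8 + Real.sqrt ((∑ k, D k ^ 2) / 8))) ≤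
      ∫ ω, (∫ ω', min 1 (Real.exp (F ω - F ω')) ∂Measure.pi (fun _ : ι => μ))
        ∂(Measure.pi (fun _ : ι => μ)).tilted (fun ω => -F ω) := by
  have hmgf := mcdiarmid_integral_exp_le μ hF hD (-1)
  have hvar := variance_le_of_bddDiff μ hF hD
  simp only [neg_one_mul] at hmgf
  have ha : (-1 : ℝ) ^ 2 * (∑ k, D k ^ 2) / 8 = (∑ k, D k ^ 2) / 8 := by ring
  rw [ha] at hmgf
  have h := latticeIndep_exp_neg_le_meanAccept_of_mgf_of_variance μ hF hmgf hvar
  have hsqrt : Real.sqrt ((∑ k, D k ^ 2) / 4 / 2) = Real.sqrt ((∑ k, D k ^ 2) / 8) := by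
    congr 1; ring
  rw [hsqrt] at h
  exact h

/-! ## §3 The `τ_int` ceiling for events -/

/-- **THE `τ_int` CEILING FROM BOUNDED DIFFERENCES (compact sites)**: for every measurable event `A` of
target probability `p` (`p·∫e^{−F}dπ = ∫_A e^{−F}dπ`, `0 < p < 1`), the integrated autocorrelation time
of `1_A − p` along the exact chain `imhOp π e^{−F} 1` satisfies
`τ_int(1_A) ≤ ½ + 12·(p∨(1−p))/(p∧(1−p))·e^{ΣD_k²/2}`. -/
theorem latticeIndep_event_tauInt_le_of_bddDiff {F : (ι → X) → ℝ} (hF : Continuous F)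
    {D : ι → ℝ} (hD : ∀ ω k v v', F (update ω k v) - F (update ω k v') ≤ D k)
    {A : Set (ι → X)} (hA : MeasurableSet A) {p : ℝ} (hp0 : 0 < p) (hp1 : p < 1)
    (hpA : p * ∫ ω, Real.exp (-F ω) ∂Measure.pi (fun _ : ι => μ) =
      ∫ ω in A, Real.exp (-F ω) ∂Measure.pi (fun _ : ι => μ)) :
    tauInt (fun k => (∫ ω, (A.indicator (fun _ => (1 : ℝ)) ω - p) *
        ((imhOp (Measure.pi (fun _ : ι => μ)) (fun η => Real.exp (-F η)) (fun _ => (1 : ℝ)))^[k]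
          (fun ω => A.indicator (fun _ => (1 : ℝ)) ω - p)) ω * Real.exp (-F ω)
          ∂Measure.pi (fun _ : ι => μ)) /
        ∫ ω, (A.indicator (fun _ => (1 : ℝ)) ω - p) ^ 2 * Real.exp (-F ω) ∂Measure.pi (fun _ : ι => μ)) ≤
      1 / 2 + 12 * (max p (1 - p) / min p (1 - p)) * Real.exp ((∑ k, D k ^ 2) / 2) := by
  have hZpos : 0 < ∫ ω, Real.exp (-F ω) ∂Measure.pi (fun _ : ι => μ) :=
    integral_exp_pos (integrable_pi_of_continuous μ (Real.continuous_exp.comp hF.neg))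
  have hZ2 : 0 < (∫ ω, Real.exp (-F ω) ∂Measure.pi (fun _ : ι => μ)) ^ 2 := pow_pos hZpos 2
  have hA0 : 0 < ∫ ω in A, Real.exp (-F ω) ∂Measure.pi (fun _ : ι => μ) := by
    rw [← hpA]; positivity
  have hA1 : ∫ ω in A, Real.exp (-F ω) ∂Measure.pi (fun _ : ι => μ) <
      ∫ ω, Real.exp (-F ω) ∂Measure.pi (fun _ : ι => μ) := by
    rw [← hpA]; nlinarith
  have hsand := (latticeIndep_event_tauInt_sandwich μ hF hA hA0 hA1).2
  have hpq : (∫ ω in A, Real.exp (-F ω) ∂Measure.pi (fun _ : ι => μ)) /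
      (∫ ω, Real.exp (-F ω) ∂Measure.pi (fun _ : ι => μ)) = p := by
    rw [← hpA, mul_div_assoc, div_self hZpos.ne', mul_one]
  rw [hpq] at hsand
  refine hsand.trans ?_
  have hratio : (∫ ω, Real.exp (-2 * F ω) ∂Measure.pi (fun _ : ι => μ)) /
      (∫ ω, Real.exp (-F ω) ∂Measure.pi (fun _ : ι => μ)) ^ 2 ≤ Real.exp ((∑ k, D k ^ 2) / 2) := by
    rw [div_le_iff₀ hZ2]
    exact latticeIndep_integral_exp_neg_two_mul_le_of_bddDiff μ hF hD
  have hcoef : 0 ≤ 12 * (max p (1 - p) / min p (1 - p)) := by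
    have hq : 0 < 1 - p := by linarith
    have : 0 < min p (1 - p) := lt_min hp0 hq
    positivity
  linarith [mul_le_mul_of_nonneg_left hratio hcoef]

end Summit.Ventures.LatticeQCDFlow.Exactness

end
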